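import Summits.BirchSwinnertonDyer.Rank1Residual.Iwasawa.LambdaInvariantValuationLayer
import Summits.BirchSwinnertonDyer.Rank1Residual.Iwasawa.LambdaInvariantZeroSetTwisted
import HarnessLib

/-!
# Valuations of twisted special values in the cyclotomic tower: `v_p` of the Birch sums
# `∑_a χ(a)[a/p^m]⁺_f` of a `p`-adic `L`-function / of a Mazur–Tate element is
# `μ + λ/φ(pⁿ⁺¹)`, and ONE Birch sum of valuation `< 1` certifies `μ = 0` and `λ`
# (cell `b2b-bsdres`; class-agnostic kernel support for the (μ, λ) censuses of iw-1 / iw-2 and the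
# validity rule of iw-2's ENGINE T; prover unit `b2b-bsdres-additive-p3`, gen 10; part 3/4)

HONEST FRAMING (run/shared/lean/b2b/bsd-rank1-residual/, verbatim in every file): the goal of the
cell is to DELETE the COMBINATION-SHAPED residual classes of the Birch–Swinnerton-Dyer formula for
ALL analytic-rank `≤ 1` elliptic curves over `ℚ` — "full BSD formula for every rank `≤ 1` curve in
class `C`" assembled STRICTLY from published theorems — so that the rank-`≤ 1` remainder becomes
exactly the CONSTRUCTION-SHAPED classes, which are TYPED (missing-input `Prop`s), NOT attempted.
This is not "finishing BSD". THEOREMS ONLY; no definition, no named fact; nothing about any curve is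
asserted; nothing booked; no label changes.

## What this file proves (parts 1–2: `LambdaInvariantValuation.lean`, `LambdaInvariantValuationLayer.lean`)

Parts 1–2 proved, for `G ∈ Λ = ℤ_p⟦T⟧`, `G ≠ 0`, and `ζ ∈ ℂ_p` of order `pⁿ⁺¹`: if
`λ(G) < φ(pⁿ⁺¹)` then `|G(ζ − 1)| = p^{−μ(G)}·|ζ − 1|^{λ(G)}`, `|ζ − 1|^{φ(pⁿ⁺¹)} = 1/p`; and
`|G(ζ − 1)| > 1/p` FORCES `μ(G) = 0`, `λ(G) < φ(pⁿ⁺¹)`, `|G(ζ − 1)|^{φ(pⁿ⁺¹)} = p^{−λ(G)}`. Here: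

* §6 **the orbit product** (what an engine computes as the `p`-adic valuation `V` of the FIELD NORM
  `N_{ℚ(μ_{pⁿ⁺¹})/ℚ}` of one value): `∏_{ζ of order pⁿ⁺¹} |G(ζ − 1)| = p^{−(φ(pⁿ⁺¹)·μ(G) + λ(G))}`
  when `λ(G) < φ(pⁿ⁺¹)` (`prod_norm_tsum_eq_of_lam_lt_totient`), and conversely
  **`∏_ζ |G(ζ − 1)| = p^{−V}` with `V < φ(pⁿ⁺¹)` ⇒ `μ(G) = 0 ∧ λ(G) = V`**
  (`mu_eq_zero_and_lam_eq_of_prod_norm_tsum_eq`) — ENGINE-T.md §0 verbatim: "`V := v_p(Norm S_ψ)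
  ≤ e_n − 1 ⟹ μ(θ_n) = 0` and `λ(θ_n) = V`";
* §7 **`p`-adic `L`-functions** with the Mazur–Tate–Teitelbaum twisted interpolation clause `hI` for
  `(f, α)` (shared by the tree's `IsPAdicLFunctionOf` / `IsMultPAdicLFunctionOf` /
  `IsSplitMultPAdicLFunctionOf`) and an integral model `ι(G) = ϖ·L`: for every primitive even
  `p`-power-order `χ` of conductor `p^{n+1+e₀}` with values in `ℂ_p` (`χ(γ)` has order `pⁿ⁺¹`),
  `|ϖ·α^{−(n+1+e₀)}·∑_a χ(a)[a/p^{n+1+e₀}]⁺_f| = p^{−μ(G)}·|χ(γ) − 1|^{λ(G)}` if `λ(G) < φ(pⁿ⁺¹)`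
  (`norm_twist_eq_of_lam_lt_totient`, `…_pow_totient_eq…`); the ONE-VALUE CERTIFICATE
  (`mu_eq_zero_and_lam_lt_totient_of_lt_norm_twist`, integer form
  `mu_eq_zero_and_lam_eq_of_norm_twist_pow_eq`) and the undetermined regime
  (`norm_twist_le_iff`); at a good ORDINARY prime (`α = unitRoot`, a unit; interpolation = tree
  theorem) the same for `|ϖ·Birch(χ)|` (`ordinary_norm_twist_pow_totient_eq_of_lam_lt_totient`,
  `ordinary_mu_eq_zero_and_lam_eq_of_norm_twist_pow_eq`);
* §8 **Mazur–Tate elements (ANY prime, supersingular included)**: `Θ ≠ 0` an integral model of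
  `θ_{k+1}` (`ι(Θ) = θ_{k+1}`, tree `mazurTateElement`): for every primitive even `p`-power-order `χ`
  of conductor `p^{k+1+e₀}`, **`|∑_a χ(a)[a/p^{k+1+e₀}]⁺_f| = p^{−μ(Θ)}·|χ(γ) − 1|^{λ(Θ)}` if
  `λ(Θ) < φ(pᵏ⁺¹)`**, i.e. `v_p(Birch sum) = μ(θ_{k+1}) + λ(θ_{k+1})/φ(pᵏ⁺¹)`
  (`mazurTate_norm_ratTwistedSymbolSum_eq_of_lam_lt_totient`); **ONE Birch sum with
  `|Birch| > 1/p` certifies `μ(Θ) = 0` and `λ(Θ) = φ(pᵏ⁺¹)·v_p(Birch)`**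
  (`mazurTate_mu_eq_zero_and_lam_lt_totient_of_lt_norm`, integer form
  `mazurTate_mu_eq_zero_and_lam_eq_of_norm_pow_eq`), and `|Birch| ≤ 1/p ↔ μ(Θ) ≥ 1 ∨ λ(Θ) ≥ φ(pᵏ⁺¹)`
  (`mazurTate_norm_le_iff`) — the validity rule of ENGINE T (`e_n = φ(pⁿ)`, `n = k + 1`) and of
  MU-CERTIFICATES §1 as kernel theorems about the tree's `θ_n`. The complex twisted `L`-VALUES enter
  through Birch's formula `τ(χ̄)·L(f, χ, 1) = (∑ χ̄(a)[a/M]⁺_f)·Ω⁺_f` (tree theorem; an identity in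
  `ℚ(μ_{p^∞})` whose images under `ℚ(μ_{p^∞}) ↪ ℂ_p` are the Birch sums here — the engines'
  bookkeeping). Sprung's `L♯/L♭` on class X8 follow in `Supersingular/MazurTateValuation.lean`.

References (ATTRIBUTION; proofs self-contained): [Washington1997] §7.1–7.2, Thm. 7.3;
[MazurTateTeitelbaum1986Invent] §I.8 (8.6), §I.12–I.14; [Pollack2003] Prop. 6.9–6.10;
HOME/b2b-bsdres-iw-2/ENGINE-T.md §0; HOME/b2b-bsdres-additive-p3/X8-ROUTE-B.md §15 (gen 10).
-/

set_option autoImplicit false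

noncomputable section

open scoped Classical MatrixGroups ModularForm

open CongruenceSubgroup Polynomial WeierstrassCurve Literature.NumberTheory.EllipticCurves
  Literature.NumberTheory.EllipticCurves.ModularForms
  Literature.NumberTheory.EllipticCurves.GreenbergVatsal2000
  Summit.BirchSwinnertonDyer.Rank1Residual.X1.MuLambda
  Summit.BirchSwinnertonDyer.Rank1Residual.X11a
  Summit.BirchSwinnertonDyer.Rank1Residual.Supersingular

namespace Summit.BirchSwinnertonDyer.Rank1Residual.Iwasawa

variable {p : ℕ} [hp : Fact p.Prime]

/-! ## §6. The orbit product: ENGINE T's field norm -/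

section Orbit

/-- **The product over a layer.** For `G ∈ Λ ∖ {0}` with `λ(G) < φ(pⁿ⁺¹)`:
`∏_{ζ of order pⁿ⁺¹} |G(ζ − 1)| = p^{−(φ(pⁿ⁺¹)·μ(G) + λ(G))}` — the `φ(pⁿ⁺¹)` factors are all
`p^{−μ(G)}·|ζ − 1|^{λ(G)}` and `|ζ − 1|^{φ(pⁿ⁺¹)} = 1/p`. [cite: Washington1997, §7.1–7.2 and Thm. 7.3] -/
theorem prod_norm_tsum_eq_of_lam_lt_totient {G : IwasawaAlgebra p} (hG0 : G ≠ 0) {n : ℕ}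
    {ζ₀ : ℂ_[p]} (hζ₀ : IsPrimitiveRoot ζ₀ (p ^ (n + 1))) (hlam : lam G < Nat.totient (p ^ (n + 1))) :
    ∏ ζ ∈ primitiveRoots (p ^ (n + 1)) ℂ_[p],
      ‖∑' k, ((algebraMap ℚ_[p] ℂ_[p]).comp (algebraMap ℤ_[p] ℚ_[p])) (PowerSeries.coeff k G) *
        (ζ - 1) ^ k‖ = ((p : ℝ)⁻¹) ^ (Nat.totient (p ^ (n + 1)) * mu G + lam G) := by
  have hpos : 0 < p ^ (n + 1) := pow_pos hp.out.pos _
  have hconst : ∀ ζ ∈ primitiveRoots (p ^ (n + 1)) ℂ_[p],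
      ‖∑' k, ((algebraMap ℚ_[p] ℂ_[p]).comp (algebraMap ℤ_[p] ℚ_[p])) (PowerSeries.coeff k G) *
        (ζ - 1) ^ k‖ = ((p : ℝ)⁻¹) ^ mu G * ‖ζ₀ - 1‖ ^ lam G := by
    intro ζ hζ
    rw [mem_primitiveRoots hpos] at hζ
    rw [norm_tsum_eq_of_lam_lt_totient hG0 hζ hlam, norm_sub_one_eq_of_isPrimitiveRoot hζ₀ hζ]
  rw [Finset.prod_congr rfl hconst, Finset.prod_const, hζ₀.card_primitiveRoots, mul_pow, ← pow_mul,
    show (‖ζ₀ - 1‖ ^ lam G) ^ Nat.totient (p ^ (n + 1)) =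
        (‖ζ₀ - 1‖ ^ Nat.totient (p ^ (n + 1))) ^ lam G by rw [← pow_mul, ← pow_mul, mul_comm],
    norm_sub_one_pow_totient_eq hζ₀, ← pow_add]
  congr 1
  ring

/-- Each factor of the layer product is `≤ 1/p` OUTSIDE the regime `μ(G) = 0 ∧ λ(G) < φ(pⁿ⁺¹)`, so
then the product is `≤ p^{−φ(pⁿ⁺¹)}`. [cite: Washington1997, §7.1–7.2 and Thm. 7.3] -/
theorem prod_norm_tsum_le_of_not {G : IwasawaAlgebra p} (hG0 : G ≠ 0) {n : ℕ}
    {ζ₀ : ℂ_[p]} (hζ₀ : IsPrimitiveRoot ζ₀ (p ^ (n + 1)))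
    (h : ¬ (mu G = 0 ∧ lam G < Nat.totient (p ^ (n + 1)))) :
    ∏ ζ ∈ primitiveRoots (p ^ (n + 1)) ℂ_[p],
      ‖∑' k, ((algebraMap ℚ_[p] ℂ_[p]).comp (algebraMap ℤ_[p] ℚ_[p])) (PowerSeries.coeff k G) *
        (ζ - 1) ^ k‖ ≤ ((p : ℝ)⁻¹) ^ Nat.totient (p ^ (n + 1)) := by
  have hpos : 0 < p ^ (n + 1) := pow_pos hp.out.pos _
  have hor : 1 ≤ mu G ∨ Nat.totient (p ^ (n + 1)) ≤ lam G := by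
    by_contra hcon
    rw [not_or, not_le, not_le, Nat.lt_one_iff] at hcon
    exact h hcon
  rw [← hζ₀.card_primitiveRoots, ← Finset.prod_const]
  refine Finset.prod_le_prod (fun ζ _ ↦ norm_nonneg _) fun ζ hζ ↦ ?_
  rw [mem_primitiveRoots hpos] at hζ
  exact (norm_tsum_le_iff_one_le_mu_or_totient_le_lam hG0 hζ).mpr hor

/-- **ENGINE T's validity rule as a theorem**: if the layer product is `p^{−V}` with
`V < φ(pⁿ⁺¹)` (`V` = the `p`-adic valuation of the field norm of one value of the layer), then
`μ(G) = 0` and `λ(G) = V`. [cite: Washington1997, §7.1–7.2 and Thm. 7.3] -/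
theorem mu_eq_zero_and_lam_eq_of_prod_norm_tsum_eq {G : IwasawaAlgebra p} (hG0 : G ≠ 0) {n : ℕ}
    {ζ₀ : ℂ_[p]} (hζ₀ : IsPrimitiveRoot ζ₀ (p ^ (n + 1))) {V : ℕ} (hV : V < Nat.totient (p ^ (n + 1)))
    (h : ∏ ζ ∈ primitiveRoots (p ^ (n + 1)) ℂ_[p],
      ‖∑' k, ((algebraMap ℚ_[p] ℂ_[p]).comp (algebraMap ℤ_[p] ℚ_[p])) (PowerSeries.coeff k G) *
        (ζ - 1) ^ k‖ = ((p : ℝ)⁻¹) ^ V) :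
    mu G = 0 ∧ lam G = V := by
  obtain ⟨hq0, hq1⟩ := inv_prime_pos_and_lt_one (p := p)
  by_cases hreg : mu G = 0 ∧ lam G < Nat.totient (p ^ (n + 1))
  · obtain ⟨hμ, hlam⟩ := hreg
    refine ⟨hμ, ?_⟩
    have h' := prod_norm_tsum_eq_of_lam_lt_totient hG0 hζ₀ hlam
    rw [h, hμ, mul_zero, zero_add] at h'
    exact (pow_right_injective₀ hq0 hq1.ne h').symm
  · have hle := prod_norm_tsum_le_of_not hG0 hζ₀ hreg
    rw [h] at hle
    exact absurd ((pow_lt_pow_iff_right_of_lt_one₀ hq0 hq1).mpr hV) (not_lt.mpr hle)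

end Orbit

/-! ## §7. `p`-adic `L`-functions with the twisted interpolation clause -/

section Twists

variable {N : ℕ} {f : CuspForm (Gamma0 N) 2}

/-- **Valuation of a twisted special value.** `L ∈ ℚ_p⟦T⟧` with the twisted interpolation clause
`hI` for `(f, α)`, integral model `ι(G) = ϖ·L`, `G ≠ 0`; `χ` a primitive even `p`-power-order
character of conductor `p^{n+1+e₀}` with values in `ℂ_p`. If `λ(G) < φ(pⁿ⁺¹)` then
`|ϖ·α^{−(n+1+e₀)}·∑_a χ(a)[a/p^{n+1+e₀}]⁺_f| = p^{−μ(G)}·|χ(γ) − 1|^{λ(G)}`.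
[cite: MazurTateTeitelbaum1986Invent, §I.13–I.14] [cite: Washington1997, §7.1–7.2 and Thm. 7.3] -/
theorem norm_twist_eq_of_lam_lt_totient {α : ℚ_[p]} {L : PowerSeries ℚ_[p]}
    (hI : ∀ (m : ℕ), 0 < m → ∀ χ : DirichletCharacter ℂ_[p] (p ^ m), χ.IsPrimitive → χ.Even →
      (∃ j : ℕ, orderOf χ = p ^ j) →
        HasSum (fun k : ℕ ↦ algebraMap ℚ_[p] ℂ_[p] (PowerSeries.coeff k L) *
            (χ (cyclotomicGenerator p : ZMod (p ^ m)) - 1) ^ k)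
          (algebraMap ℚ_[p] ℂ_[p] (α⁻¹ ^ m) * ratTwistedSymbolSum f χ))
    {G : IwasawaAlgebra p} {ϖ : ℚ_[p]} (hG : iwasawaToPowerSeries p G = PowerSeries.C ϖ * L)
    (hG0 : G ≠ 0) {n : ℕ} (χ : DirichletCharacter ℂ_[p] (p ^ (n + 1 + cyclotomicExponent p)))
    (hχ : χ.IsPrimitive) (heven : χ.Even) (hord : ∃ j : ℕ, orderOf χ = p ^ j)
    (hlam : lam G < Nat.totient (p ^ (n + 1))) :
    ‖algebraMap ℚ_[p] ℂ_[p] ϖ * (algebraMap ℚ_[p] ℂ_[p] (α⁻¹ ^ (n + 1 + cyclotomicExponent p)) *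
      ratTwistedSymbolSum f χ)‖ =
      ((p : ℝ)⁻¹) ^ mu G *
        ‖χ (cyclotomicGenerator p : ZMod (p ^ (n + 1 + cyclotomicExponent p))) - 1‖ ^ lam G := by
  have hm : 0 < n + 1 + cyclotomicExponent p := by omega
  rw [← (hasSum_integralModel_eq_ratTwistedSymbolSum hI hG hm χ hχ heven hord).tsum_eq]
  exact norm_tsum_eq_of_lam_lt_totient hG0
    (isPrimitiveRoot_apply_cyclotomicGenerator χ hχ heven hord) hlam

/-- **Same, raised to `φ(pⁿ⁺¹)`**: `|ϖ·α^{−m}·Birch(χ)|^{φ(pⁿ⁺¹)} = p^{−(φ(pⁿ⁺¹)·μ(G) + λ(G))}`.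
[cite: MazurTateTeitelbaum1986Invent, §I.13–I.14] [cite: Washington1997, §7.1–7.2 and Thm. 7.3] -/
theorem norm_twist_pow_totient_eq_of_lam_lt_totient {α : ℚ_[p]} {L : PowerSeries ℚ_[p]}
    (hI : ∀ (m : ℕ), 0 < m → ∀ χ : DirichletCharacter ℂ_[p] (p ^ m), χ.IsPrimitive → χ.Even →
      (∃ j : ℕ, orderOf χ = p ^ j) →
        HasSum (fun k : ℕ ↦ algebraMap ℚ_[p] ℂ_[p] (PowerSeries.coeff k L) *
            (χ (cyclotomicGenerator p : ZMod (p ^ m)) - 1) ^ k)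
          (algebraMap ℚ_[p] ℂ_[p] (α⁻¹ ^ m) * ratTwistedSymbolSum f χ))
    {G : IwasawaAlgebra p} {ϖ : ℚ_[p]} (hG : iwasawaToPowerSeries p G = PowerSeries.C ϖ * L)
    (hG0 : G ≠ 0) {n : ℕ} (χ : DirichletCharacter ℂ_[p] (p ^ (n + 1 + cyclotomicExponent p)))
    (hχ : χ.IsPrimitive) (heven : χ.Even) (hord : ∃ j : ℕ, orderOf χ = p ^ j)
    (hlam : lam G < Nat.totient (p ^ (n + 1))) :
    ‖algebraMap ℚ_[p] ℂ_[p] ϖ * (algebraMap ℚ_[p] ℂ_[p] (α⁻¹ ^ (n + 1 + cyclotomicExponent p)) *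
      ratTwistedSymbolSum f χ)‖ ^ Nat.totient (p ^ (n + 1)) =
      ((p : ℝ)⁻¹) ^ (Nat.totient (p ^ (n + 1)) * mu G + lam G) := by
  have hm : 0 < n + 1 + cyclotomicExponent p := by omega
  rw [← (hasSum_integralModel_eq_ratTwistedSymbolSum hI hG hm χ hχ heven hord).tsum_eq]
  exact norm_tsum_pow_totient_eq_of_lam_lt_totient hG0
    (isPrimitiveRoot_apply_cyclotomicGenerator χ hχ heven hord) hlam

/-- **ONE twisted value certifies `μ = 0` and `λ`**: if
`|ϖ·α^{−m}·∑_a χ(a)[a/p^m]⁺_f| > 1/p` for ONE primitive even `p`-power-order `χ` of conductor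
`p^m = p^{n+1+e₀}`, then `μ(G) = 0`, `λ(G) < φ(pⁿ⁺¹)` and
`|ϖ·α^{−m}·Birch(χ)|^{φ(pⁿ⁺¹)} = p^{−λ(G)}`. [cite: MazurTateTeitelbaum1986Invent, §I.13–I.14]
[cite: Washington1997, §7.1–7.2 and Thm. 7.3] -/
theorem mu_eq_zero_and_lam_lt_totient_of_lt_norm_twist {α : ℚ_[p]} {L : PowerSeries ℚ_[p]}
    (hI : ∀ (m : ℕ), 0 < m → ∀ χ : DirichletCharacter ℂ_[p] (p ^ m), χ.IsPrimitive → χ.Even →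
      (∃ j : ℕ, orderOf χ = p ^ j) →
        HasSum (fun k : ℕ ↦ algebraMap ℚ_[p] ℂ_[p] (PowerSeries.coeff k L) *
            (χ (cyclotomicGenerator p : ZMod (p ^ m)) - 1) ^ k)
          (algebraMap ℚ_[p] ℂ_[p] (α⁻¹ ^ m) * ratTwistedSymbolSum f χ))
    {G : IwasawaAlgebra p} {ϖ : ℚ_[p]} (hG : iwasawaToPowerSeries p G = PowerSeries.C ϖ * L)
    (hG0 : G ≠ 0) {n : ℕ} (χ : DirichletCharacter ℂ_[p] (p ^ (n + 1 + cyclotomicExponent p)))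
    (hχ : χ.IsPrimitive) (heven : χ.Even) (hord : ∃ j : ℕ, orderOf χ = p ^ j)
    (h : (p : ℝ)⁻¹ < ‖algebraMap ℚ_[p] ℂ_[p] ϖ *
      (algebraMap ℚ_[p] ℂ_[p] (α⁻¹ ^ (n + 1 + cyclotomicExponent p)) * ratTwistedSymbolSum f χ)‖) :
    mu G = 0 ∧ lam G < Nat.totient (p ^ (n + 1)) ∧
      ‖algebraMap ℚ_[p] ℂ_[p] ϖ * (algebraMap ℚ_[p] ℂ_[p] (α⁻¹ ^ (n + 1 + cyclotomicExponent p)) *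
        ratTwistedSymbolSum f χ)‖ ^ Nat.totient (p ^ (n + 1)) = ((p : ℝ)⁻¹) ^ lam G := by
  have hm : 0 < n + 1 + cyclotomicExponent p := by omega
  rw [← (hasSum_integralModel_eq_ratTwistedSymbolSum hI hG hm χ hχ heven hord).tsum_eq] at h ⊢
  exact mu_eq_zero_and_lam_lt_totient_of_lt_norm_tsum hG0
    (isPrimitiveRoot_apply_cyclotomicGenerator χ hχ heven hord) h

/-- **Integer form**: `|ϖ·α^{−m}·Birch(χ)|^{φ(pⁿ⁺¹)} = p^{−V}` with `V < φ(pⁿ⁺¹)` ⇒ `μ(G) = 0` and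
`λ(G) = V`. [cite: MazurTateTeitelbaum1986Invent, §I.13–I.14] [cite: Washington1997, §7.1–7.2 and Thm. 7.3] -/
theorem mu_eq_zero_and_lam_eq_of_norm_twist_pow_eq {α : ℚ_[p]} {L : PowerSeries ℚ_[p]}
    (hI : ∀ (m : ℕ), 0 < m → ∀ χ : DirichletCharacter ℂ_[p] (p ^ m), χ.IsPrimitive → χ.Even →
      (∃ j : ℕ, orderOf χ = p ^ j) →
        HasSum (fun k : ℕ ↦ algebraMap ℚ_[p] ℂ_[p] (PowerSeries.coeff k L) *
            (χ (cyclotomicGenerator p : ZMod (p ^ m)) - 1) ^ k)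
          (algebraMap ℚ_[p] ℂ_[p] (α⁻¹ ^ m) * ratTwistedSymbolSum f χ))
    {G : IwasawaAlgebra p} {ϖ : ℚ_[p]} (hG : iwasawaToPowerSeries p G = PowerSeries.C ϖ * L)
    (hG0 : G ≠ 0) {n : ℕ} (χ : DirichletCharacter ℂ_[p] (p ^ (n + 1 + cyclotomicExponent p)))
    (hχ : χ.IsPrimitive) (heven : χ.Even) (hord : ∃ j : ℕ, orderOf χ = p ^ j) {V : ℕ}
    (hV : V < Nat.totient (p ^ (n + 1)))
    (h : ‖algebraMap ℚ_[p] ℂ_[p] ϖ * (algebraMap ℚ_[p] ℂ_[p] (α⁻¹ ^ (n + 1 + cyclotomicExponent p)) *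
      ratTwistedSymbolSum f χ)‖ ^ Nat.totient (p ^ (n + 1)) = ((p : ℝ)⁻¹) ^ V) :
    mu G = 0 ∧ lam G = V := by
  have hm : 0 < n + 1 + cyclotomicExponent p := by omega
  rw [← (hasSum_integralModel_eq_ratTwistedSymbolSum hI hG hm χ hχ heven hord).tsum_eq] at h
  exact mu_eq_zero_and_lam_eq_of_norm_tsum_pow_eq hG0
    (isPrimitiveRoot_apply_cyclotomicGenerator χ hχ heven hord) hV h

/-- **The undetermined regime**: `|ϖ·α^{−m}·Birch(χ)| ≤ 1/p ↔ (μ(G) ≥ 1 ∨ λ(G) ≥ φ(pⁿ⁺¹))`.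
[cite: MazurTateTeitelbaum1986Invent, §I.13–I.14] [cite: Washington1997, §7.1–7.2 and Thm. 7.3] -/
theorem norm_twist_le_iff {α : ℚ_[p]} {L : PowerSeries ℚ_[p]}
    (hI : ∀ (m : ℕ), 0 < m → ∀ χ : DirichletCharacter ℂ_[p] (p ^ m), χ.IsPrimitive → χ.Even →
      (∃ j : ℕ, orderOf χ = p ^ j) →
        HasSum (fun k : ℕ ↦ algebraMap ℚ_[p] ℂ_[p] (PowerSeries.coeff k L) *
            (χ (cyclotomicGenerator p : ZMod (p ^ m)) - 1) ^ k)
          (algebraMap ℚ_[p] ℂ_[p] (α⁻¹ ^ m) * ratTwistedSymbolSum f χ))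
    {G : IwasawaAlgebra p} {ϖ : ℚ_[p]} (hG : iwasawaToPowerSeries p G = PowerSeries.C ϖ * L)
    (hG0 : G ≠ 0) {n : ℕ} (χ : DirichletCharacter ℂ_[p] (p ^ (n + 1 + cyclotomicExponent p)))
    (hχ : χ.IsPrimitive) (heven : χ.Even) (hord : ∃ j : ℕ, orderOf χ = p ^ j) :
    ‖algebraMap ℚ_[p] ℂ_[p] ϖ * (algebraMap ℚ_[p] ℂ_[p] (α⁻¹ ^ (n + 1 + cyclotomicExponent p)) *
      ratTwistedSymbolSum f χ)‖ ≤ (p : ℝ)⁻¹ ↔ 1 ≤ mu G ∨ Nat.totient (p ^ (n + 1)) ≤ lam G := by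
  have hm : 0 < n + 1 + cyclotomicExponent p := by omega
  rw [← (hasSum_integralModel_eq_ratTwistedSymbolSum hI hG hm χ hχ heven hord).tsum_eq]
  exact norm_tsum_le_iff_one_le_mu_or_totient_le_lam hG0
    (isPrimitiveRoot_apply_cyclotomicGenerator χ hχ heven hord)

end Twists

/-! ## §7b. Good ordinary `p`: `α = unitRoot` is a unit, so the statements are about `|ϖ·Birch(χ)|` -/

section Ordinary

variable {N : ℕ} [NeZero N] {f : CuspForm (Gamma0 N) 2} {W : WeierstrassCurve ℚ} [W.IsElliptic]
  [W.IsGloballyMinimal]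

omit [W.IsElliptic] in
/-- `|α⁻¹ ^ m| = 1` for the unit root `α` at a good ordinary prime. [folklore] -/
theorem norm_algebraMap_unitRoot_inv_pow (hord : IsOrdinaryAt W p) (m : ℕ) :
    ‖algebraMap ℚ_[p] ℂ_[p] ((unitRoot W p : ℚ_[p])⁻¹ ^ m)‖ = 1 := by
  rw [norm_algebraMap', norm_pow, norm_inv, norm_unitRoot_holds W p hord, inv_one, one_pow]

/-- **Good ordinary `p`: valuation of the twisted special values of `L_p(E,T)`.** `G` an integral
model of `L_p(E,T) = padicLFunction f (unitRoot W p)` (`ι(G) = ϖ·L_p`, `G ≠ 0`; interpolation =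
tree theorem): for every primitive even `p`-power-order `χ` of conductor `p^{n+1+e₀}` with
`λ(G) < φ(pⁿ⁺¹)`, `|ϖ·∑_a χ(a)[a/p^{n+1+e₀}]⁺_f|^{φ(pⁿ⁺¹)} = p^{−(φ(pⁿ⁺¹)·μ(G) + λ(G))}`.
[cite: MazurSwinnertonDyer1974Invent, §9] [cite: MazurTateTeitelbaum1986Invent, §I.14 (14.3)] -/
theorem ordinary_norm_twist_pow_totient_eq_of_lam_lt_totient (hord : IsOrdinaryAt W p)
    (hf : IsNewformOf W f) {G : IwasawaAlgebra p} {ϖ : ℚ_[p]}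
    (hG : iwasawaToPowerSeries p G = PowerSeries.C ϖ * padicLFunction f (unitRoot W p : ℚ_[p]))
    (hG0 : G ≠ 0) {n : ℕ} (χ : DirichletCharacter ℂ_[p] (p ^ (n + 1 + cyclotomicExponent p)))
    (hχ : χ.IsPrimitive) (heven : χ.Even) (hordχ : ∃ j : ℕ, orderOf χ = p ^ j)
    (hlam : lam G < Nat.totient (p ^ (n + 1))) :
    ‖algebraMap ℚ_[p] ℂ_[p] ϖ * ratTwistedSymbolSum f χ‖ ^ Nat.totient (p ^ (n + 1)) =
      ((p : ℝ)⁻¹) ^ (Nat.totient (p ^ (n + 1)) * mu G + lam G) := by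
  have h := norm_twist_pow_totient_eq_of_lam_lt_totient
    (isPAdicLFunctionOf_padicLFunction_holds hord hf).2 hG hG0 χ hχ heven hordχ hlam
  rwa [norm_mul, norm_mul, norm_algebraMap_unitRoot_inv_pow hord, one_mul, ← norm_mul] at h

/-- **Good ordinary `p`: ONE twisted value certifies `(μ, λ)`.** If
`|ϖ·∑_a χ(a)[a/p^{n+1+e₀}]⁺_f|^{φ(pⁿ⁺¹)} = p^{−V}` with `V < φ(pⁿ⁺¹)` for one primitive even
`p`-power-order `χ` of that conductor, then `μ(G) = 0` and `λ(G) = V`.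
[cite: MazurSwinnertonDyer1974Invent, §9] [cite: MazurTateTeitelbaum1986Invent, §I.14 (14.3)] -/
theorem ordinary_mu_eq_zero_and_lam_eq_of_norm_twist_pow_eq (hord : IsOrdinaryAt W p)
    (hf : IsNewformOf W f) {G : IwasawaAlgebra p} {ϖ : ℚ_[p]}
    (hG : iwasawaToPowerSeries p G = PowerSeries.C ϖ * padicLFunction f (unitRoot W p : ℚ_[p]))
    (hG0 : G ≠ 0) {n : ℕ} (χ : DirichletCharacter ℂ_[p] (p ^ (n + 1 + cyclotomicExponent p)))
    (hχ : χ.IsPrimitive) (heven : χ.Even) (hordχ : ∃ j : ℕ, orderOf χ = p ^ j) {V : ℕ}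
    (hV : V < Nat.totient (p ^ (n + 1)))
    (h : ‖algebraMap ℚ_[p] ℂ_[p] ϖ * ratTwistedSymbolSum f χ‖ ^ Nat.totient (p ^ (n + 1)) =
      ((p : ℝ)⁻¹) ^ V) :
    mu G = 0 ∧ lam G = V := by
  refine mu_eq_zero_and_lam_eq_of_norm_twist_pow_eq
    (isPAdicLFunctionOf_padicLFunction_holds hord hf).2 hG hG0 χ hχ heven hordχ hV ?_
  rw [norm_mul, norm_mul, norm_algebraMap_unitRoot_inv_pow hord, one_mul, ← norm_mul, h]

end Ordinary

/-! ## §8. Mazur–Tate elements (any good prime): the ENGINE T / MU-CERTIFICATES rule in the kernel -/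

section MazurTate

variable {N : ℕ} {f : CuspForm (Gamma0 N) 2}

/-- **Valuation of the Birch sums of a Mazur–Tate element.** `Θ ≠ 0` an integral model of
`θ_{k+1}` (`ι(Θ) = θ_{k+1}`); `χ` a primitive even `p`-power-order character mod `p^{k+1+e₀}` with
values in `ℂ_p` (so `χ(γ)` has order `pᵏ⁺¹` and `Θ(χ(γ) − 1) = ∑_a χ(a)[a/p^{k+1+e₀}]⁺_f`). If
`λ(Θ) < φ(pᵏ⁺¹)` then **`|∑_a χ(a)[a/p^{k+1+e₀}]⁺_f| = p^{−μ(Θ)}·|χ(γ) − 1|^{λ(Θ)}`**, i.e.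
`v_p(Birch sum) = μ(θ_{k+1}) + λ(θ_{k+1})/φ(pᵏ⁺¹)`. [cite: MazurTateTeitelbaum1986Invent, §I.8 and §I.12]
[cite: Pollack2003, Prop. 6.9 and Prop. 6.10] [cite: Washington1997, §7.1–7.2 and Thm. 7.3] -/
theorem mazurTate_norm_ratTwistedSymbolSum_eq_of_lam_lt_totient {k : ℕ} {Θ : IwasawaAlgebra p}
    (hΘ : iwasawaToPowerSeries p Θ =
      ((mazurTateElement f p (k + 1)).map (algebraMap ℚ ℚ_[p]) : PowerSeries ℚ_[p]))
    (hΘ0 : Θ ≠ 0) (χ : DirichletCharacter ℂ_[p] (p ^ (k + 1 + cyclotomicExponent p)))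
    (hχ : χ.IsPrimitive) (hev : χ.Even) (hord : ∃ j : ℕ, orderOf χ = p ^ j)
    (hlam : lam Θ < Nat.totient (p ^ (k + 1))) :
    ‖ratTwistedSymbolSum f χ‖ = ((p : ℝ)⁻¹) ^ mu Θ *
      ‖χ (cyclotomicGenerator p : ZMod (p ^ (k + 1 + cyclotomicExponent p))) - 1‖ ^ lam Θ := by
  rw [← (hasSum_mazurTate_eq_ratTwistedSymbolSum hΘ χ hev hord).tsum_eq]
  exact norm_tsum_eq_of_lam_lt_totient hΘ0 (isPrimitiveRoot_apply_cyclotomicGenerator χ hχ hev hord)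
    hlam

/-- **Same, raised to `φ(pᵏ⁺¹)`**: `|Birch(χ)|^{φ(pᵏ⁺¹)} = p^{−(φ(pᵏ⁺¹)·μ(Θ) + λ(Θ))}` — the
`p`-adic valuation of the field norm of the Birch sum over its `φ(pᵏ⁺¹)` conjugates.
[cite: MazurTateTeitelbaum1986Invent, §I.8 and §I.12] [cite: Washington1997, §7.1–7.2 and Thm. 7.3] -/
theorem mazurTate_norm_ratTwistedSymbolSum_pow_totient_eq_of_lam_lt_totient {k : ℕ}
    {Θ : IwasawaAlgebra p}
    (hΘ : iwasawaToPowerSeries p Θ =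
      ((mazurTateElement f p (k + 1)).map (algebraMap ℚ ℚ_[p]) : PowerSeries ℚ_[p]))
    (hΘ0 : Θ ≠ 0) (χ : DirichletCharacter ℂ_[p] (p ^ (k + 1 + cyclotomicExponent p)))
    (hχ : χ.IsPrimitive) (hev : χ.Even) (hord : ∃ j : ℕ, orderOf χ = p ^ j)
    (hlam : lam Θ < Nat.totient (p ^ (k + 1))) :
    ‖ratTwistedSymbolSum f χ‖ ^ Nat.totient (p ^ (k + 1)) =
      ((p : ℝ)⁻¹) ^ (Nat.totient (p ^ (k + 1)) * mu Θ + lam Θ) := by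
  rw [← (hasSum_mazurTate_eq_ratTwistedSymbolSum hΘ χ hev hord).tsum_eq]
  exact norm_tsum_pow_totient_eq_of_lam_lt_totient hΘ0
    (isPrimitiveRoot_apply_cyclotomicGenerator χ hχ hev hord) hlam

/-- **THE CERTIFICATE (ENGINE T §0 / MU-CERTIFICATES §1 as a theorem).** `Θ ≠ 0` an integral model
of `θ_{k+1}`: if ONE primitive even `p`-power-order `χ` of conductor `p^{k+1+e₀}` has
**`|∑_a χ(a)[a/p^{k+1+e₀}]⁺_f| > 1/p`**, then `μ(Θ) = 0`, `λ(Θ) < φ(pᵏ⁺¹)` and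
`|Birch(χ)|^{φ(pᵏ⁺¹)} = p^{−λ(Θ)}` — `λ(θ_{k+1}) = φ(pᵏ⁺¹)·v_p(Birch(χ))`.
[cite: MazurTateTeitelbaum1986Invent, §I.8 and §I.12] [cite: Pollack2003, Prop. 6.9 and Prop. 6.10]
[cite: Washington1997, §7.1–7.2 and Thm. 7.3] -/
theorem mazurTate_mu_eq_zero_and_lam_lt_totient_of_lt_norm {k : ℕ} {Θ : IwasawaAlgebra p}
    (hΘ : iwasawaToPowerSeries p Θ =
      ((mazurTateElement f p (k + 1)).map (algebraMap ℚ ℚ_[p]) : PowerSeries ℚ_[p]))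
    (hΘ0 : Θ ≠ 0) (χ : DirichletCharacter ℂ_[p] (p ^ (k + 1 + cyclotomicExponent p)))
    (hχ : χ.IsPrimitive) (hev : χ.Even) (hord : ∃ j : ℕ, orderOf χ = p ^ j)
    (h : (p : ℝ)⁻¹ < ‖ratTwistedSymbolSum f χ‖) :
    mu Θ = 0 ∧ lam Θ < Nat.totient (p ^ (k + 1)) ∧
      ‖ratTwistedSymbolSum f χ‖ ^ Nat.totient (p ^ (k + 1)) = ((p : ℝ)⁻¹) ^ lam Θ := by
  rw [← (hasSum_mazurTate_eq_ratTwistedSymbolSum hΘ χ hev hord).tsum_eq] at h ⊢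
  exact mu_eq_zero_and_lam_lt_totient_of_lt_norm_tsum hΘ0
    (isPrimitiveRoot_apply_cyclotomicGenerator χ hχ hev hord) h

/-- **Integer form of the certificate**: `|Birch(χ)|^{φ(pᵏ⁺¹)} = p^{−V}` with `V < φ(pᵏ⁺¹)`
(ENGINE T: `V := v_p(Norm S_ψ) ≤ e_{k+1} − 1`) ⇒ `μ(Θ) = 0 ∧ λ(Θ) = V`.
[cite: MazurTateTeitelbaum1986Invent, §I.8 and §I.12] [cite: Washington1997, §7.1–7.2 and Thm. 7.3] -/
theorem mazurTate_mu_eq_zero_and_lam_eq_of_norm_pow_eq {k : ℕ} {Θ : IwasawaAlgebra p}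
    (hΘ : iwasawaToPowerSeries p Θ =
      ((mazurTateElement f p (k + 1)).map (algebraMap ℚ ℚ_[p]) : PowerSeries ℚ_[p]))
    (hΘ0 : Θ ≠ 0) (χ : DirichletCharacter ℂ_[p] (p ^ (k + 1 + cyclotomicExponent p)))
    (hχ : χ.IsPrimitive) (hev : χ.Even) (hord : ∃ j : ℕ, orderOf χ = p ^ j) {V : ℕ}
    (hV : V < Nat.totient (p ^ (k + 1)))
    (h : ‖ratTwistedSymbolSum f χ‖ ^ Nat.totient (p ^ (k + 1)) = ((p : ℝ)⁻¹) ^ V) :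
    mu Θ = 0 ∧ lam Θ = V := by
  rw [← (hasSum_mazurTate_eq_ratTwistedSymbolSum hΘ χ hev hord).tsum_eq] at h
  exact mu_eq_zero_and_lam_eq_of_norm_tsum_pow_eq hΘ0
    (isPrimitiveRoot_apply_cyclotomicGenerator χ hχ hev hord) hV h

/-- **The undetermined regime** (ENGINE T: "`V ≥ e_n ⟹` undetermined: `λ(θ_n) ≥ e_n` or
`μ(θ_n) > 0`"): `|Birch(χ)| ≤ 1/p ↔ (μ(Θ) ≥ 1 ∨ λ(Θ) ≥ φ(pᵏ⁺¹))`.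
[cite: MazurTateTeitelbaum1986Invent, §I.8 and §I.12] [cite: Washington1997, §7.1–7.2 and Thm. 7.3] -/
theorem mazurTate_norm_le_iff {k : ℕ} {Θ : IwasawaAlgebra p}
    (hΘ : iwasawaToPowerSeries p Θ =
      ((mazurTateElement f p (k + 1)).map (algebraMap ℚ ℚ_[p]) : PowerSeries ℚ_[p]))
    (hΘ0 : Θ ≠ 0) (χ : DirichletCharacter ℂ_[p] (p ^ (k + 1 + cyclotomicExponent p)))
    (hχ : χ.IsPrimitive) (hev : χ.Even) (hord : ∃ j : ℕ, orderOf χ = p ^ j) :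
    ‖ratTwistedSymbolSum f χ‖ ≤ (p : ℝ)⁻¹ ↔ 1 ≤ mu Θ ∨ Nat.totient (p ^ (k + 1)) ≤ lam Θ := by
  rw [← (hasSum_mazurTate_eq_ratTwistedSymbolSum hΘ χ hev hord).tsum_eq]
  exact norm_tsum_le_iff_one_le_mu_or_totient_le_lam hΘ0
    (isPrimitiveRoot_apply_cyclotomicGenerator χ hχ hev hord)

end MazurTate

end Summit.BirchSwinnertonDyer.Rank1Residual.Iwasawa

end
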